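import Summits.Ventures.YMGap.RobustBall.FineBall
import Summits.Ventures.YMGap.RobustBall.TermPerturbation
import HarnessLib

/-!
# RobustBall/TermPerturbationFine — reads-incidence loads of a term perturbation (the `FineBall` upgrade layer)
(cell `pub-ymgap`, track Y2 ROBUST-BALL, T0.2 witnesses; p1)

HONEST FRAMING: elementary finite-torus bookkeeping (no probability, no continuum, no Clay claim). For the assembled
perturbation `termPerturbation T` of a finite family of local terms (`RobustBall/TermPerturbation`) we bound the
READS-incidence loads of `RobustBall/FineBall` (`oscLoadF`, `selfLipLoadF + crossLipLoadF`, indexed by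
`polymersReading`): a polymer that READS the link `e` carries a term whose letters contain `e`
(`exists_mem_fiber_of_reads`), so — provided fiber-mates read the same links (`SameLinksOnFibers`, automatic for an
injective code) — only the terms THROUGH THE LINK `e` are charged:
`oscLoadF 0 e ≤ Σ_r oscC_r · mult_r(e)`, `selfLipLoadF 0 e + crossLipLoadF 0 e ≤ Σ_{r : e ∈ links r} lipC_r · |letters_r|`,
hence membership in `ClusterDomainFRFine` from two counting bounds.
-/

noncomputable section

open MeasureTheory Finset Function
open Literature.Probability.LatticeModels Literature.Probability.LatticeModels.DobrushinMetric
open Literature.MathematicalPhysics.QuantumLattice hiding torusNorm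
open Literature.MathematicalPhysics.QuantumFieldTheory hiding ZdEdge

namespace Summit.Ventures.YMGap.RobustBall

variable {d L N : ℕ} {ι : Type*} (T : ι → LocalTerm d L N)

/-- Fiber-mates read the same links: terms placed on the same polymer have the same link sets (automatic when the
code is injective; holds for the two orientations of a parallel pair). [folklore] -/
def SameLinksOnFibers : Prop :=
  ∀ r r', (T r).code = (T r').code → wordEdges (T r).letters = wordEdges (T r').letters

/-- An injective code trivially has `SameLinksOnFibers`. [folklore] -/
theorem sameLinksOnFibers_of_injective (hinj : Function.Injective fun r => (T r).code) : SameLinksOnFibers T :=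
  fun _ _ h => by rw [hinj h]

variable [Fintype ι]

/-- With `SameLinksOnFibers`, sums over (codes of terms through `e`) × (fiber) collapse to sums over the terms through
`e`. [folklore] -/
theorem sum_image_fiber_eq (hT : SameLinksOnFibers T) (e : Edge d L) (g : ι → ℝ) :
    ∑ X ∈ (univ.filter fun r => e ∈ wordEdges (T r).letters).image (fun r => (T r).code), ∑ r ∈ fiber T X, g r =
      ∑ r, if e ∈ wordEdges (T r).letters then g r else 0 := by
  simp only [fiber]
  rw [sum_fiberwise_eq_sum_filter, sum_filter]
  refine sum_congr rfl fun r _ => ?_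
  congr 1
  simp only [mem_image, mem_filter, mem_univ, true_and, eq_iff_iff]
  constructor
  · rintro ⟨r', hr', hcode⟩
    rwa [hT r r' hcode.symm]
  · exact fun h => ⟨r, h, rfl⟩

variable [NeZero L]

/-- **A polymer that READS `e` carries a term through the link `e`.** [folklore] -/
theorem exists_mem_fiber_of_reads {X : Finset (Site d L)} {e : Edge d L} (h : Reads (termPerturbation T) X e) :
    ∃ r ∈ fiber T X, e ∈ wordEdges (T r).letters := by
  by_contra hne
  obtain ⟨U, g, hU⟩ := h
  refine hU (sum_congr rfl fun r hr => (T r).dependsOn fun e' he' => ?_)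
  have hne' : e' ≠ e := fun h' => hne ⟨r, hr, h' ▸ Finset.mem_coe.1 he'⟩
  rw [Function.update_of_ne hne']

/-- The polymers reading `e` are codes of terms through the LINK `e`. [folklore] -/
theorem polymersReading_subset_image (e : Edge d L) :
    polymersReading (termPerturbation T) e ⊆ (univ.filter fun r => e ∈ wordEdges (T r).letters).image fun r => (T r).code := by
  intro X hX
  obtain ⟨r, hr, he⟩ := exists_mem_fiber_of_reads T (mem_polymersReading_iff.1 hX).2
  exact mem_image.2 ⟨r, mem_filter.2 ⟨mem_univ _, he⟩, (mem_fiber T).1 hr⟩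

/-- **Reads-incidence oscillation load**: `oscLoadF 0 e ≤ Σ_r oscC_r · mult_r(e)`. [folklore] -/
theorem oscLoadF_le_sum (e : Edge d L) :
    (termLoadWitness T).oscLoadF 0 e ≤ ∑ r, (T r).oscC * (mult (T r).letters e : ℝ) :=
  ((termLoadWitness T).oscLoadF_le 0 e).trans (oscLoad_eq T e).le

/-- **Reads-incidence self-Lipschitz load**: `selfLipLoadF 0 e ≤ Σ_r lipC_r · mult_r(e)`. [folklore] -/
theorem selfLipLoadF_le_sum (e : Edge d L) :
    (termLoadWitness T).selfLipLoadF 0 e ≤ ∑ r, (T r).lipC * (mult (T r).letters e : ℝ) :=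
  ((termLoadWitness T).selfLipLoadF_le 0 e).trans (selfLipLoad_eq T e).le

/-- **Reads-incidence cross-Lipschitz coefficient**: `crossLipF 0 e y ≤ Σ_{r : e ∈ links r} lipC_r · mult_r(y)` —
only terms through the LINK `e` are charged. [folklore] -/
theorem crossLipF_le_sum (hT : SameLinksOnFibers T) (e y : Edge d L) :
    (termLoadWitness T).crossLipF 0 e y ≤
      ∑ r, if e ∈ wordEdges (T r).letters then (T r).lipC * (mult (T r).letters y : ℝ) else 0 := by
  classical
  have hnn : ∀ X, 0 ≤ (termLoadWitness T).lip X y := fun X => ((termLoadWitness T).lip_spec X).nonneg y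
  simp only [LoadWitness.crossLipF, zero_mul, Real.exp_zero, one_mul]
  calc ∑ X ∈ (polymersReading (termPerturbation T) e).filter (fun X => Reads (termPerturbation T) X y),
          (termLoadWitness T).lip X y
      ≤ ∑ X ∈ polymersReading (termPerturbation T) e, (termLoadWitness T).lip X y :=
        sum_le_sum_of_subset_of_nonneg (filter_subset _ _) fun X _ _ => hnn X
    _ ≤ ∑ X ∈ (univ.filter fun r => e ∈ wordEdges (T r).letters).image (fun r => (T r).code),
          (termLoadWitness T).lip X y :=
        sum_le_sum_of_subset_of_nonneg (polymersReading_subset_image T e) fun X _ _ => hnn X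
    _ = ∑ r, if e ∈ wordEdges (T r).letters then (T r).lipC * (mult (T r).letters y : ℝ) else 0 := by
        simp only [termLoadWitness_lip]
        exact sum_image_fiber_eq T hT e _

/-- **Reads-incidence total Lipschitz load**: `selfLipLoadF 0 e + crossLipLoadF 0 e ≤ Σ_{r : e ∈ links r} lipC_r·|letters_r|`
— the Lipschitz mass of the terms through the LINK `e` only. [folklore] -/
theorem selfLipLoadF_add_crossLipLoadF_le (hT : SameLinksOnFibers T) (e : Edge d L) :
    (termLoadWitness T).selfLipLoadF 0 e + (termLoadWitness T).crossLipLoadF 0 e ≤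
      ∑ r, if e ∈ wordEdges (T r).letters then (T r).lipC * ((T r).letters.length : ℝ) else 0 := by
  have h1 := selfLipLoadF_le_sum T e
  have h2 : (termLoadWitness T).crossLipLoadF 0 e ≤
      ∑ y ∈ univ.erase e, ∑ r, if e ∈ wordEdges (T r).letters then (T r).lipC * (mult (T r).letters y : ℝ) else 0 :=
    sum_le_sum fun y _ => crossLipF_le_sum T hT e y
  refine (add_le_add h1 h2).trans (le_of_eq ?_)
  rw [sum_comm, ← sum_add_distrib]
  refine sum_congr rfl fun r _ => ?_
  by_cases h : e ∈ wordEdges (T r).letters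
  · simp only [if_pos h, ← mul_sum, ← mul_add]
    congr 1
    rw [Finset.add_sum_erase univ (fun y => (mult (T r).letters y : ℝ)) (mem_univ e)]
    exact_mod_cast sum_mult_eq_length (T r).letters
  · simp only [if_neg h, sum_const_zero, add_zero, mult_eq_zero_iff.2 h, Nat.cast_zero, mul_zero]

/-- **Membership in the reads-incidence tier-1 ball from two counts**: if every code has diameter `≤ R`,
`Σ_r oscC_r·mult_r(e) ≤ ε₀` and `Σ_{r : e ∈ links r} lipC_r·|letters_r| ≤ ε₁` at every link `e`, and fiber-mates read
the same links, then `termPerturbation T ∈ ClusterDomainFRFine ε₀ ε₁ R`. [folklore] -/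
theorem termPerturbation_mem_clusterDomainFRFine (hT : SameLinksOnFibers T) {R : ℕ} {ε₀ ε₁ : ℝ}
    (hR : ∀ r, polymerDiam (T r).code ≤ R)
    (h₀ : ∀ e : Edge d L, ∑ r, (T r).oscC * (mult (T r).letters e : ℝ) ≤ ε₀)
    (h₁ : ∀ e : Edge d L,
      ∑ r, (if e ∈ wordEdges (T r).letters then (T r).lipC * ((T r).letters.length : ℝ) else 0) ≤ ε₁) :
    termPerturbation T ∈ ClusterDomainFRFine ε₀ ε₁ R :=
  ⟨hasRange_termPerturbation T hR, termLoadWitness T, fun e => (oscLoadF_le_sum T e).trans (h₀ e),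
    fun e => (selfLipLoadF_add_crossLipLoadF_le T hT e).trans (h₁ e)⟩

/-! ### Vertical windows shared along fibers (non-injective codes) -/

/-- **Vertical dependence diameter** from per-term windows that are valid for every FIBER-MATE (terms with the same
polymer): no injectivity of the code is needed. [folklore] -/
theorem hasVertRange_termPerturbation_of_fibers {m : ℕ}
    (hwin : ∀ r (v : Fin d), ∃ t₀ : ZMod L, ∀ r', (T r').code = (T r).code →
      ∀ l ∈ (T r').letters, l.dir = v → ∃ k : ℕ, k < m ∧ l.site v = t₀ + k) :
    HasVertRange m (termPerturbation T) := by
  intro X v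
  by_cases hX : ∃ r, (T r).code = X
  · obtain ⟨r, rfl⟩ := hX
    obtain ⟨t₀, ht₀⟩ := hwin r v
    refine ⟨t₀, fun U V h => ?_⟩
    simp only [termPerturbation_act]
    refine sum_congr rfl fun r' hr' => (T r').dependsOn fun e he => h e ?_
    obtain ⟨l, hl, rfl⟩ := mem_wordEdges.1 (Finset.mem_coe.1 he)
    by_cases hv : l.dir = v
    · obtain ⟨k, hk, hkt⟩ := ht₀ r' ((mem_fiber T).1 hr') l hl hv
      exact Or.inr ⟨k, hk, hkt⟩
    · exact Or.inl hv
  · refine ⟨0, fun U V _ => ?_⟩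
    simp only [termPerturbation_act]
    rw [sum_eq_zero fun r hr => ?_, sum_eq_zero fun r hr => ?_] <;>
      exact absurd ⟨r, (mem_fiber T).1 hr⟩ hX

/-- **`IsSlabLocal m`** from centre-invariant terms and fiber-shared windows. [folklore] -/
theorem isSlabLocal_termPerturbation_of_fibers {m : ℕ}
    (hc : ∀ r (v : Fin d) (t : ZMod L) (z : SUN N), z ∈ Subgroup.center (SUN N) →
      ∀ U, (T r).act (centerSlabRotate v t z U) = (T r).act U)
    (hwin : ∀ r (v : Fin d), ∃ t₀ : ZMod L, ∀ r', (T r').code = (T r).code →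
      ∀ l ∈ (T r').letters, l.dir = v → ∃ k : ℕ, k < m ∧ l.site v = t₀ + k) :
    IsSlabLocal m (termPerturbation T) :=
  ⟨fun v t _ hz U => total_centerSlabRotate T hc v t hz U, hasVertRange_termPerturbation_of_fibers T hwin⟩

end Summit.Ventures.YMGap.RobustBall

end
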